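import Summits.QuantumFields.YangMills.Theorems.LuscherReductionRunningReductionUniformFloor
import Summits.QuantumFields.YangMills.Theorems.LuscherReductionRunningReductionActionPhase
import HarnessLib

/-!
# Target texts of the near-vacuum core of COARSE-UPPER(L): VALLEY GAIN `V(L)`, INNER NO-INTRUDER `I(L)`, admissible IMS scales, and the
# Born–Oppenheimer upper comparison `BO_up(L)` (fixed-lattice programme COARSE(L₀) — route `LuscherReduction`, crux RED stmt-QuantumFields-19978
# KT-door 3b′ / crux `TwistedTraceScaling` stmt-QuantumFields-20203 S-BASE; design note `pub/ym-fleet/ym-luscher-20007-p1/COARSE-DESIGN.md` §7–§8)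

The onion theorem (`qform_le_three_regions_lat`, `…ActionPhase`) splits the transfer form of a physical zero-flux `ψ` on `(ℤ/L)³` into an INNER piece
(`cos Θ_δ ψ`, near a twisted pure-gauge orbit), a VALLEY piece (`cos Θ'_η · sin Θ_δ ψ`: small action, away from the orbits) and an error
`onionErr L β δ η · c_β^{|E|} · ‖ψ‖²`; the β-uniform floor (`levelValue_zero_ge_uniform`, `…UniformFloor`) makes that error affordable.  This file
NAMES the two genuinely semiclassical statements that remain, as functions of the IMS scales `δ, η : ℝ → ℝ` (radius / action threshold as functions
of `β`), and the statement they imply (next file, `…CoarseUpperGlue`):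
* `onionErr L β δ η = e^{−βη} + ½|E|²(3/β)((8π/δ)² + (4π|P|/η)²)`; `ScalesAdmissible L δ η`: both scales positive and
  `onionErr = o(λ_b(L³β)) · uniformFloorConst L` as `β → ∞`;
* `ValleyGainAt L δ η` — **V(L)** (sub-stub C3): for every `A`, eventually in `β`, every physical `φ` supported in the VALLEY
  `{S < 2η(β)} ∩ {∀ z, orbitDist(τ_z U) > δ(β)/2}` has `⟨φ,K_βφ⟩ ≤ e^{−A·λ_b(L³β)} λ₀(β,L) ‖φ‖²` (relative form: the unknown stiff-mode factor of
  `λ₀` cancels; physically the gain is the transverse zero-point energy along the toron valley, `≫ λ_b`);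
* `InnerNoIntruderAt L δ` — **I(L)** (sub-stub C4, upper direction, in SUBSPACE form): for every `k`, `ε > 0`, eventually in `β`, every
  `(k+1)`-family of physical functions supported in the INNER region `{∃ z, orbitDist(τ_z U) < δ(β)}` with nondegenerate Gram matrix contains a
  nonzero combination `ψ` with `⟨ψ,Kψ⟩ · μ₀ ≤ e^{ε λ_b} · μ_k · λ₀ · ‖ψ‖²` (`μ_j = levelValue su2Rep 1 (L³β) j`, the one-site levels at the natural
  coupling) — min–max for the Dirichlet-compressed problem against the one-site model (Born–Oppenheimer projection onto the stiff ground state);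
* `BOUpperAt L` — **BO_up(L)**, VERBATIM the hypothesis `hBO` of the tree's `coarseNoIntruderAt_of_boUpper` (`…BOHandover`):
  `∀ k ε>0, ∃ β0, ∀ β ≥ β0, λ_k μ₀ ≤ e^{ελ_b(L³β)} μ_k λ₀`.
HONEST FRAMING: statements only (no proofs here); `V(L)` and `I(L)` are OPEN (C3: L/XL, C4: XL); femto rung R2b1; not a gap, not infinite volume, not Clay.
-/

set_option autoImplicit false

noncomputable section

open MeasureTheory Filter Topology Real
open scoped BigOperators
open Literature.MathematicalPhysics.QuantumFieldTheory
open Literature.MathematicalPhysics.QuantumLattice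

namespace Summit.QuantumFields.YangMills.Theorems.FemtoTransferGap

variable (L : ℕ) [NeZero L]

/-- **Onion error coefficient** `onionErr L β δ η = e^{−βη} + ½|E|²(3/β)((8π/δ)² + (4π|P|/η)²)` — the coefficient of `c_β^{|E|}‖ψ‖²` in the onion
theorem `qform_le_three_regions_lat` (large-field Schur bound + the two link-Lipschitz IMS defects). [cite: SimonB1983DiscreteSpectrum, §3] -/
def onionErr (β δ η : ℝ) : ℝ :=
  Real.exp (-(β * η)) + (1 / 2) * ((Fintype.card (Edge 3 L) : ℝ) ^ 2 * (3 / β) *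
    ((8 * π / δ) ^ 2 + (4 * π * Fintype.card (Plaquette 3 L) / η) ^ 2))

/-- **Admissible IMS scales** `δ, η : ℝ → ℝ` (functions of `β`): positive, and the onion error is `o(λ_b(L³β))` in units of the β-uniform floor
constant — `∀ κ > 0`, eventually `onionErr L β (δ β) (η β) ≤ κ · bareLambda(L³β) · uniformFloorConst L`.  (E.g. `δ = η = β^{−1/4}`: the error
is `O(β^{−1/2}) = o(β^{−1/3})`.)  A hypothesis shape of this programme. -/
def ScalesAdmissible (δ η : ℝ → ℝ) : Prop :=
  (∀ β : ℝ, 0 < δ β) ∧ (∀ β : ℝ, 0 < η β) ∧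
    ∀ κ : ℝ, 0 < κ → ∃ β0 : ℝ, ∀ β : ℝ, β0 ≤ β →
      onionErr L β (δ β) (η β) ≤ κ * bareLambda ((L : ℝ) ^ 3 * β) * uniformFloorConst L

/-- **V(L) — VALLEY GAIN at scales `(δ, η)`** (sub-stub C3 of COARSE(L); OPEN).  For every `A`, eventually in `β`, every physical zero-flux `φ`
supported in the valley `{S(U) < 2η(β)} ∩ {∀ z, δ(β)/2 < orbitDist(τ_z U)}` satisfies `⟨φ, K_β φ⟩ ≤ e^{−A·λ_b(L³β)} · λ₀(β, L) · ‖φ‖²`.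
Why it should hold: away from the eight twisted pure-gauge orbits but at small action the configuration sits in the toron valley at distance
`≳ δ ≫ β^{−1/3}` (one-site units `≫ 1`), where the transverse zero-point energy exceeds any fixed multiple of `λ_b`; method: weighted Schur test with
the stiff Gaussian ground state built into the weight (so that the stiff factor of `λ₀` cancels), as crux ONE's VALLEY (Lüscher 1983 §3,
Lüscher–Münster 1984 §2).  Target text of this programme, not a published theorem. -/
def ValleyGainAt (δ η : ℝ → ℝ) : Prop :=
  ∀ A : ℝ, ∃ β0 : ℝ, ∀ β : ℝ, β0 ≤ β → ∀ φ : GaugeConfig 3 L SU2 → ℝ, IsPhys φ →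
    (∀ U, φ U ≠ 0 → wilsonAction su2Rep U < 2 * η β ∧ ∀ z : Fin 3 → Bool, δ β / 2 < orbitDist (TT.twist3 z U)) →
      qform su2Rep β φ φ ≤ Real.exp (-(A * bareLambda ((L : ℝ) ^ 3 * β))) * levelValue su2Rep L β 0 * l2 φ φ

/-- **I(L) — INNER NO-INTRUDER at scale `δ`, subspace form** (sub-stub C4 of COARSE(L), upper direction; OPEN, XL).  For every level `k` and
`ε > 0`, eventually in `β`: every family `F₀ … F_k` of physical zero-flux functions supported in the inner region `{∃ z, orbitDist(τ_z U) < δ(β)}`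
with nondegenerate Gram matrix has a nonzero linear combination `ψ = Σ aᵢFᵢ` with `⟨ψ,K_βψ⟩ · μ₀ ≤ e^{ε λ_b(L³β)} · μ_k · λ₀(β,L) · ‖ψ‖²`, where
`μ_j = levelValue su2Rep 1 (L³β) j` are the ONE-SITE levels at the natural coupling `B' = L³β`.  (Min–max for the problem compressed to the inner
region, compared with the one-site model: Born–Oppenheimer projection onto the stiff Gaussian ground state in the comb gauge, `K_L` on constants
`= K_1(L³β)` by `transferKernel_constLift`, and the trial-function bound `λ₀ ≳ G·μ₀` for the normalisation; Lüscher 1983 §3, Simon 1983 §3.)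
Target text of this programme, not a published theorem. -/
def InnerNoIntruderAt (δ : ℝ → ℝ) : Prop :=
  ∀ k : ℕ, ∀ ε : ℝ, 0 < ε → ∃ β0 : ℝ, ∀ β : ℝ, β0 ≤ β →
    ∀ F : Fin (k + 1) → (GaugeConfig 3 L SU2 → ℝ), (∀ i, IsPhys (F i)) →
      (∀ i U, F i U ≠ 0 → ∃ z : Fin 3 → Bool, orbitDist (TT.twist3 z U) < δ β) →
      (∀ a : Fin (k + 1) → ℝ, a ≠ 0 → 0 < l2 (fun U => ∑ i, a i * F i U) (fun U => ∑ i, a i * F i U)) →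
        ∃ a : Fin (k + 1) → ℝ, a ≠ 0 ∧
          qform su2Rep β (fun U => ∑ i, a i * F i U) (fun U => ∑ i, a i * F i U) * levelValue su2Rep 1 ((L : ℝ) ^ 3 * β) 0 ≤
            Real.exp (ε * bareLambda ((L : ℝ) ^ 3 * β)) * levelValue su2Rep 1 ((L : ℝ) ^ 3 * β) k * levelValue su2Rep L β 0 *
              l2 (fun U => ∑ i, a i * F i U) (fun U => ∑ i, a i * F i U)

/-- **BO_up(L) — the Born–Oppenheimer upper comparison** of the `L³`-lattice level ratios with the one-site ratios at the natural coupling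
(VERBATIM the hypothesis `hBO` of the tree's `coarseNoIntruderAt_of_boUpper`): `∀ k, ∀ ε > 0, ∃ β0, ∀ β ≥ β0, λ_k·μ₀ ≤ e^{ε λ_b(L³β)}·(μ_k·λ₀)`.
With crux ONE (closed) it gives COARSE-UPPER(L) (`BOHandover.coarseNoIntruderAt_of_boUpper`; Lüscher 1983 §3).  Target text, not a published theorem. -/
def BOUpperAt : Prop :=
  ∀ k : ℕ, ∀ ε : ℝ, 0 < ε → ∃ β0 : ℝ, ∀ β : ℝ, β0 ≤ β →
    levelValue su2Rep L β k * levelValue su2Rep 1 ((L : ℝ) ^ 3 * β) 0 ≤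
      Real.exp (ε * bareLambda ((L : ℝ) ^ 3 * β)) * (levelValue su2Rep 1 ((L : ℝ) ^ 3 * β) k * levelValue su2Rep L β 0)

variable {L}

/-- `0 < onionErr` for positive scales and `β > 0`. [folklore] -/
theorem onionErr_pos {β δ η : ℝ} (hβ : 0 < β) : 0 < onionErr L β δ η := by
  unfold onionErr
  positivity

/-- The onion theorem in the notation of this file: `⟨ψ,Kψ⟩ ≤ ⟨ψ_in,Kψ_in⟩ + ⟨ψ_val,Kψ_val⟩ + onionErr·c_β^{|E|}·‖ψ‖²`. [cite: SimonB1983DiscreteSpectrum, §3] -/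
theorem qform_le_three_regions_onionErr {β : ℝ} (hβ : 0 < β) {δ η : ℝ} (hδ : 0 < δ) (hη : 0 < η)
    {ψ : GaugeConfig 3 L SU2 → ℝ} (hψ : IsPhys ψ) :
    qform su2Rep β ψ ψ ≤
      qform su2Rep β (fun U => Real.cos (innerPhase δ U) * ψ U) (fun U => Real.cos (innerPhase δ U) * ψ U)
      + qform su2Rep β (fun U => Real.cos (actionPhase η U) * (Real.sin (innerPhase δ U) * ψ U))
          (fun U => Real.cos (actionPhase η U) * (Real.sin (innerPhase δ U) * ψ U))
      + onionErr L β δ η * latCE L β * l2 ψ ψ :=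
  qform_le_three_regions_lat hβ hδ hη hψ

end Summit.QuantumFields.YangMills.Theorems.FemtoTransferGap

end
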